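import Summits.QuantumFields.YangMills.Theorems.SoloBlindOddTorusRP
import Summits.QuantumFields.YangMills.Theorems.SoloBlindSinglePlaquette
import HarnessLib

/-!
# SoloBlind: exponential observables of finite sets of plaquettes (`YangMills`)

Solo seat `solo-QuantumFields-blind`, deliverable D12, part 1 of 3 (the symmetry toolkit for the
odd-torus chessboard estimate `SoloBlindOddChessboard` → `SoloBlindExpMoment`).

For a finite set `A` of plaquettes of the discrete torus `Λ_L = (ℤ/Lℤ)^d` and `c ∈ ℝ` the
observable `F_A(U) = exp(c ∑_{q ∈ A} φ_q(U))`, `φ_q = N - Re tr ρ(U_q)` (`expObs`), and its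
behaviour under the symmetries of the torus Wilson state `⟨·⟩_{Λ_L,β}`:

* reflection: `Θ` is an involution of the configuration space (`timeReflectMEquiv`), the Wilson
  action and the Wilson state are `Θ`-invariant (`wilsonAction_timeReflect`,
  `wilsonExpectation_comp_timeReflect`, every `β`), and `F_A ∘ Θ = F_{ϑA}` with `ϑ` the
  plaquette reflection `WilsonRP.plaqReflect` (`expObs_timeReflect`);
* translation: `⟨F_{A+v}⟩ = ⟨F_A⟩` (`plaqTranslate`, `wilsonExpectation_expObs_plaqTranslate`);
* axis exchange: `⟨F_{σA}⟩ = ⟨F_A⟩` for the transposition `σ = (a b)` of coordinate axes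
  (`plaqSwap`, `wilsonExpectation_expObs_swap`);
* monotonicity in the coupling: for `c ≥ 0` and `Re tr ρ ≤ N` (so `φ_q ≥ 0`),
  `⟨F_A⟩_{Λ,β} ≤ ⟨exp(c S)⟩_{Λ,β} = Z_Λ(β - c)/Z_Λ(β)` (`wilsonExpectation_expObs_le_exp`).

References: [OS78] K. Osterwalder, E. Seiler, Ann. Phys. 110 (1978) 440–471, §2 (symmetries of
the lattice gauge measure); the statements are elementary ([folklore]).
-/

open MeasureTheory Filter Topology
open Literature.MathematicalPhysics.QuantumFieldTheory Literature.MathematicalPhysics.QuantumLattice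

noncomputable section

namespace Summit.QuantumFields.YangMills.Theorems.SoloBlind

/-! ### The reflection of configurations is an involution; reflection invariance of the state -/

section Reflect

variable {d L N : ℕ} [NeZero d] {G : Type*} [Group G] [TopologicalSpace G] [IsTopologicalGroup G]
  [CompactSpace G] [MeasurableSpace G] [BorelSpace G] (ρ : G →* Matrix (Fin N) (Fin N) ℂ)

omit [TopologicalSpace G] [IsTopologicalGroup G] [CompactSpace G] [MeasurableSpace G]
  [BorelSpace G] in
/-- The link reflection does not change the direction of a link. [folklore] -/
theorem edgeReflect_snd (e : Edge d L) : (WilsonRP.edgeReflect e).2 = e.2 := by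
  unfold WilsonRP.edgeReflect
  split_ifs with h
  · exact h.symm
  · rfl

omit [TopologicalSpace G] [IsTopologicalGroup G] [CompactSpace G] [MeasurableSpace G]
  [BorelSpace G] in
/-- `Θ` is an involution on gauge configurations. [folklore] -/
theorem timeReflect_timeReflect_config (U : GaugeConfig d L G) :
    U.timeReflect.timeReflect = U := by
  funext e
  rw [WilsonRP.timeReflect_apply, WilsonRP.timeReflect_apply U (WilsonRP.edgeReflect e),
    edgeReflect_snd, WilsonRP.edgeReflect_edgeReflect]
  by_cases h : e.2 = 0
  · simp [h]
  · simp [h]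

omit [TopologicalSpace G] [IsTopologicalGroup G] [CompactSpace G] [BorelSpace G] in
/-- `Θ` as a measurable equivalence of the configuration space. [folklore] -/
def timeReflectMEquiv : GaugeConfig d L G ≃ᵐ GaugeConfig d L G where
  toFun := GaugeConfig.timeReflect
  invFun := GaugeConfig.timeReflect
  left_inv := timeReflect_timeReflect_config
  right_inv := timeReflect_timeReflect_config
  measurable_toFun := WilsonRP.measurable_timeReflect
  measurable_invFun := WilsonRP.measurable_timeReflect

omit [MeasurableSpace G] [BorelSpace G] in
/-- The Wilson action is reflection invariant. [folklore] -/
theorem wilsonAction_timeReflect [NeZero L] (hρ : Continuous ρ) (U : GaugeConfig d L G) :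
    wilsonAction ρ U.timeReflect = wilsonAction ρ U := by
  rw [WilsonRP.wilsonAction_eq, WilsonRP.wilsonAction_eq]
  congr 1
  simp_rw [WilsonRP.plaqRe_timeReflect ρ hρ]
  exact Fintype.sum_equiv WilsonRP.plaqReflectEquiv _ _ fun p => rfl

/-- **The torus Wilson state is reflection invariant**: `⟨F ∘ Θ⟩_{Λ,β} = ⟨F⟩_{Λ,β}` (continuous
`ρ`; every `β`, every `L`). [folklore] -/
theorem wilsonExpectation_comp_timeReflect [NeZero L] (hρ : Continuous ρ) (β : ℝ)
    (F : GaugeConfig d L G → ℝ) :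
    wilsonExpectation ρ β (fun U => F U.timeReflect) = wilsonExpectation ρ β F := by
  rw [wilsonExpectation_eq_integral_div ρ hρ β, wilsonExpectation_eq_integral_div ρ hρ β]
  congr 1
  have hmp : MeasurePreserving (GaugeConfig.timeReflect : GaugeConfig d L G → GaugeConfig d L G)
      (Measure.pi fun _ : Edge d L => haarProbability G)
      (Measure.pi fun _ : Edge d L => haarProbability G) :=
    WilsonRP.measurePreserving_timeReflect
  have hme :
      MeasurableEmbedding (GaugeConfig.timeReflect : GaugeConfig d L G → GaugeConfig d L G) :=
    (timeReflectMEquiv (d := d) (L := L) (G := G)).measurableEmbedding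
  have h := hmp.integral_comp hme
    (fun V : GaugeConfig d L G => F V * Real.exp (-β * wilsonAction ρ V))
  simp only [wilsonAction_timeReflect ρ hρ] at h
  exact h

end Reflect

/-! ### Exponential observables of finite sets of plaquettes -/

section ExpObs

variable {d L N : ℕ} {G : Type*} [Group G] [TopologicalSpace G] [IsTopologicalGroup G]
  [CompactSpace G] [MeasurableSpace G] [BorelSpace G] (ρ : G →* Matrix (Fin N) (Fin N) ℂ)

/-- `F_A(U) = exp(c ∑_{q ∈ A} φ_q(U))`, `φ_q = N - Re tr ρ(U_q)` the cost of the plaquette `q`.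
[folklore] -/
def expObs (c : ℝ) (A : Finset (Plaquette d L)) (U : GaugeConfig d L G) : ℝ :=
  Real.exp (c * ∑ q ∈ A, plaquetteCost ρ q.1 q.2.1.1 q.2.1.2 U)

omit [TopologicalSpace G] [IsTopologicalGroup G] [CompactSpace G] [MeasurableSpace G]
  [BorelSpace G] in
/-- `φ_q = N - Re tr ρ(U_q)`. [folklore] -/
theorem plaquetteCost_eq_sub_plaqRe (q : Plaquette d L) (U : GaugeConfig d L G) :
    plaquetteCost ρ q.1 q.2.1.1 q.2.1.2 U = N - WilsonRP.plaqRe ρ U q := rfl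

omit [TopologicalSpace G] [IsTopologicalGroup G] [CompactSpace G] [MeasurableSpace G]
  [BorelSpace G] in
/-- `F_A > 0`. [folklore] -/
theorem expObs_pos (c : ℝ) (A : Finset (Plaquette d L)) (U : GaugeConfig d L G) :
    0 < expObs ρ c A U := Real.exp_pos _

omit [CompactSpace G] in
/-- `F_A` is measurable. [folklore] -/
theorem measurable_expObs (hρ : Continuous ρ) (c : ℝ) (A : Finset (Plaquette d L)) :
    Measurable (expObs (G := G) ρ c A) := by
  unfold expObs
  refine Real.measurable_exp.comp (Measurable.const_mul ?_ c)
  exact Finset.measurable_sum A fun q _ => measurable_plaquetteCost ρ hρ q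

omit [MeasurableSpace G] [BorelSpace G] in
/-- `F_A` is bounded. [folklore] -/
theorem exists_abs_expObs_le (hρ : Continuous ρ) (c : ℝ) (A : Finset (Plaquette d L)) :
    ∃ C : ℝ, ∀ U : GaugeConfig d L G, |expObs ρ c A U| ≤ C := by
  refine ⟨Real.exp (|c| * (A.card * (2 * N))), fun U => ?_⟩
  rw [expObs, Real.abs_exp]
  refine Real.exp_le_exp.2 ((le_abs_self _).trans ?_)
  rw [abs_mul]
  refine mul_le_mul_of_nonneg_left ?_ (abs_nonneg c)
  calc |∑ q ∈ A, plaquetteCost ρ q.1 q.2.1.1 q.2.1.2 U|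
      ≤ ∑ q ∈ A, |plaquetteCost ρ q.1 q.2.1.1 q.2.1.2 U| := Finset.abs_sum_le_sum_abs _ _
    _ ≤ ∑ _q ∈ A, (2 * (N : ℝ)) := Finset.sum_le_sum fun q _ => abs_plaquetteCost_le ρ hρ _ _ _ U
    _ = A.card * (2 * N) := by rw [Finset.sum_const, nsmul_eq_mul]

/-- `⟨F_A⟩ ≥ 0`. [folklore] -/
theorem wilsonExpectation_expObs_nonneg [NeZero L] (β c : ℝ) (A : Finset (Plaquette d L)) :
    0 ≤ wilsonExpectation ρ β (expObs (G := G) ρ c A) :=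
  integral_nonneg fun U => (expObs_pos ρ c A U).le

/-! #### Reflection -/

omit [MeasurableSpace G] [BorelSpace G] in
/-- `F_A ∘ Θ = F_{ϑA}`. [folklore] -/
theorem expObs_timeReflect [NeZero d] (hρ : Continuous ρ) (c : ℝ) (A : Finset (Plaquette d L))
    (U : GaugeConfig d L G) :
    expObs ρ c A U.timeReflect = expObs ρ c (A.image WilsonRP.plaqReflect) U := by
  unfold expObs
  congr 2
  rw [Finset.sum_image fun q _ q' _ h => by
    simpa [WilsonRP.plaqReflect_plaqReflect] using congrArg WilsonRP.plaqReflect h]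
  refine Finset.sum_congr rfl fun q _ => ?_
  rw [plaquetteCost_eq_sub_plaqRe, plaquetteCost_eq_sub_plaqRe, WilsonRP.plaqRe_timeReflect ρ hρ]

/-! #### Translation -/

/-- The translate `A + v` of a set of plaquettes. [folklore] -/
def plaqTranslate (v : Site d L) (A : Finset (Plaquette d L)) : Finset (Plaquette d L) :=
  A.image fun q => (q.1 + v, q.2)

omit [Group G] [TopologicalSpace G] [IsTopologicalGroup G] [CompactSpace G] [MeasurableSpace G]
  [BorelSpace G] ρ in
/-- Membership in the translate. [folklore] -/
theorem mem_plaqTranslate {v : Site d L} {A : Finset (Plaquette d L)} {q : Plaquette d L} :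
    q ∈ plaqTranslate v A ↔ ∃ q₀ ∈ A, (q₀.1 + v, q₀.2) = q := by
  simp [plaqTranslate]

omit [TopologicalSpace G] [IsTopologicalGroup G] [CompactSpace G] [BorelSpace G] in
/-- `F_{A+v} ∘ τ_v = F_A` (`τ_v U (x, i) = U (x - v, i)`). [folklore] -/
theorem expObs_plaqTranslate_comp_shift (c : ℝ) (v : Site d L) (A : Finset (Plaquette d L))
    (U : GaugeConfig d L G) :
    expObs ρ c (plaqTranslate v A) (torusConfigShift v U) = expObs ρ c A U := by
  unfold expObs plaqTranslate
  congr 2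
  rw [Finset.sum_image fun q _ q' _ h => by
    have h1 := congrArg Prod.fst h
    have h2 := congrArg Prod.snd h
    simp only [add_left_inj] at h1
    exact Prod.ext h1 h2]
  refine Finset.sum_congr rfl fun q _ => ?_
  simp only [plaquetteCost, plaquetteHolonomy_torusConfigShift, add_sub_cancel_right]

/-- **Translation invariance**: `⟨F_{A+v}⟩ = ⟨F_A⟩`. [folklore] -/
theorem wilsonExpectation_expObs_plaqTranslate [NeZero L] (β c : ℝ) (v : Site d L)
    (A : Finset (Plaquette d L)) :
    wilsonExpectation ρ β (expObs (G := G) ρ c (plaqTranslate v A)) =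
      wilsonExpectation ρ β (expObs ρ c A) := by
  rw [← wilsonExpectation_comp_torusConfigShift ρ β v (expObs ρ c (plaqTranslate v A))]
  congr 1
  funext U
  exact expObs_plaqTranslate_comp_shift ρ c v A U

/-! #### Axis exchange -/

/-- The exchange of the axes `a, b` on plaquettes (base point permuted, plane permuted and
re-ordered). [folklore] -/
def plaqSwap (a b : Fin d) (p : Plaquette d L) : Plaquette d L :=
  ((fun k => p.1 (Equiv.swap a b k)),
    if h : Equiv.swap a b p.2.1.1 < Equiv.swap a b p.2.1.2 then
      ⟨(Equiv.swap a b p.2.1.1, Equiv.swap a b p.2.1.2), h⟩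
    else ⟨(Equiv.swap a b p.2.1.2, Equiv.swap a b p.2.1.1),
      (swap_lt_or_lt a b p.2.2).resolve_left h⟩)

omit [Group G] [TopologicalSpace G] [IsTopologicalGroup G] [CompactSpace G] [MeasurableSpace G]
  [BorelSpace G] ρ in
/-- The base point of the exchanged plaquette. [folklore] -/
@[simp] theorem plaqSwap_fst (a b : Fin d) (p : Plaquette d L) (k : Fin d) :
    (plaqSwap a b p).1 k = p.1 (Equiv.swap a b k) := rfl

omit [Group G] [TopologicalSpace G] [IsTopologicalGroup G] [CompactSpace G] [MeasurableSpace G]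
  [BorelSpace G] ρ in
/-- `plaqSwap a b` is an involution. [folklore] -/
theorem plaqSwap_plaqSwap (a b : Fin d) (p : Plaquette d L) :
    plaqSwap a b (plaqSwap a b p) = p := by
  obtain ⟨x, ⟨⟨i, j⟩, hij⟩⟩ := p
  unfold plaqSwap
  refine Prod.ext ?_ ?_
  · funext k
    simp only [Equiv.swap_apply_self]
  · by_cases h : Equiv.swap a b i < Equiv.swap a b j
    · simp only [h, ↓reduceDIte, Equiv.swap_apply_self, hij]
    · simp only [h, ↓reduceDIte, Equiv.swap_apply_self, dif_neg (lt_asymm hij)]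

omit [MeasurableSpace G] [BorelSpace G] in
/-- `F_A ∘ σ_{ab} = F_{σ_{ab} A}`. [folklore] -/
theorem expObs_swap (hρ : Continuous ρ) (c : ℝ) (a b : Fin d) (A : Finset (Plaquette d L))
    (U : GaugeConfig d L G) :
    expObs ρ c A (fun e : Edge d L => U ((fun k' => e.1 (Equiv.swap a b k')), Equiv.swap a b e.2)) =
      expObs ρ c (A.image (plaqSwap a b)) U := by
  unfold expObs
  congr 2
  rw [Finset.sum_image fun q _ q' _ h => by
    simpa [plaqSwap_plaqSwap] using congrArg (plaqSwap (L := L) a b) h]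
  refine Finset.sum_congr rfl fun q _ => ?_
  obtain ⟨x, ⟨⟨i, j⟩, hij⟩⟩ := q
  simp only [plaquetteCost, plaquetteHolonomy_swap]
  unfold plaqSwap
  by_cases h : Equiv.swap a b i < Equiv.swap a b j
  · simp only [h, ↓reduceDIte]
  · simp only [h, ↓reduceDIte]
    have := plaquetteCost_symm ρ hρ (fun k' => x (Equiv.swap a b k')) (Equiv.swap a b j)
      (Equiv.swap a b i) U
    simpa [plaquetteCost] using this

/-- **Axis-exchange invariance**: `⟨F_{σ_{ab} A}⟩ = ⟨F_A⟩`. [folklore] -/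
theorem wilsonExpectation_expObs_swap [NeZero L] (hρ : Continuous ρ) (β c : ℝ) (a b : Fin d)
    (A : Finset (Plaquette d L)) :
    wilsonExpectation ρ β (expObs (G := G) ρ c (A.image (plaqSwap a b))) =
      wilsonExpectation ρ β (expObs ρ c A) := by
  rw [← wilsonExpectation_comp_swap ρ hρ β a b (expObs ρ c A)]
  congr 1
  funext U
  exact (expObs_swap ρ hρ c a b A U).symm

/-! #### Monotonicity in the coupling: `⟨F_A⟩_β ≤ Z(β - c)/Z(β)` -/

omit [TopologicalSpace G] [IsTopologicalGroup G] [CompactSpace G] [MeasurableSpace G]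
  [BorelSpace G] in
/-- `φ_q ≥ 0` when `Re tr ρ ≤ N`. [folklore] -/
theorem plaquetteCost_nonneg (hρN : ∀ g, (ρ g).trace.re ≤ N) (x : Site d L) (i j : Fin d)
    (U : GaugeConfig d L G) : 0 ≤ plaquetteCost ρ x i j U := by
  unfold plaquetteCost
  linarith [hρN (plaquetteHolonomy U x i j)]

/-- **Monotonicity bound.** For `c ≥ 0` and `Re tr ρ ≤ N` (so that every plaquette cost is
non-negative), `⟨exp(c ∑_{q∈A} φ_q)⟩_{Λ,β} ≤ Z_Λ(β - c)/Z_Λ(β)`: raising the exponent from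
`c ∑_{q ∈ A} φ_q` to `c ∑_{all q} φ_q = c S` increases the integrand. [folklore] -/
theorem wilsonExpectation_expObs_le_exp [NeZero L] (hρ : Continuous ρ)
    (hρN : ∀ g, (ρ g).trace.re ≤ N) {c : ℝ} (hc : 0 ≤ c) (β : ℝ) (A : Finset (Plaquette d L)) :
    wilsonExpectation ρ β (expObs (G := G) ρ c A) ≤
      Real.exp (torusLogPartition d ρ (β - c) L - torusLogPartition d ρ β L) := by
  set π₀ : Measure (GaugeConfig d L G) := Measure.pi fun _ : Edge d L => haarProbability G with hπ₀
  have hI : ∀ b : ℝ, 0 < ∫ U, Real.exp (-b * wilsonAction ρ U) ∂π₀ := fun b =>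
    integral_exp_neg_mul_wilsonAction_pos ρ hρ b
  rw [wilsonExpectation_eq_integral_div ρ hρ β, torusLogPartition_eq_log_integral ρ hρ,
    torusLogPartition_eq_log_integral ρ hρ, Real.exp_sub, Real.exp_log (hI _), Real.exp_log (hI _)]
  refine div_le_div_of_nonneg_right ?_ (hI β).le
  have hpt : ∀ U : GaugeConfig d L G,
      expObs ρ c A U * Real.exp (-β * wilsonAction ρ U) ≤
        Real.exp (-(β - c) * wilsonAction ρ U) := by
    intro U
    rw [expObs, ← Real.exp_add]
    refine Real.exp_le_exp.2 ?_
    have hsub : ∑ q ∈ A, plaquetteCost ρ q.1 q.2.1.1 q.2.1.2 U ≤ wilsonAction ρ U := by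
      rw [wilsonAction_eq_sum_plaquetteCost]
      exact Finset.sum_le_sum_of_subset_of_nonneg (Finset.subset_univ A)
        fun q _ _ => plaquetteCost_nonneg ρ hρN _ _ _ U
    nlinarith [mul_le_mul_of_nonneg_left hsub hc]
  refine integral_mono_of_nonneg (ae_of_all _ fun U => ?_)
    (integrable_exp_mul_wilsonAction ρ hρ (-(β - c)) π₀) (ae_of_all _ hpt)
  exact mul_nonneg (expObs_pos ρ c A U).le (Real.exp_pos _).le

end ExpObs

end Summit.QuantumFields.YangMills.Theorems.SoloBlind
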